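import Literature.NumberTheory.EllipticCurves.FormalGroupMultiplicationParityProofs
import HarnessLib

/-!
# Route `TameQuarticSolvent`, crux `SolventPairLowerBound` (stmt-BirchSwinnertonDyer-21391) — Newton-polygon SLOPES
# of a `[3]`-series: root norms from coefficient norms (one slope / two slopes), and oddness of `[n]` over any ring

HONEST FRAMING. Theorems only; helper (`--supports stmt-BirchSwinnertonDyer-21391 --as helper`) of width seat
bsd-wall-tqs-p1-w2 g7; first half of the formal `3`-torsion valuation profile of the (t′) good model (sequel file
`TameQuarticSolventTprimeFormalTorsionValuationAtThree`). BSD is not proved by any of this; nothing here closes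
21391 or 23963. No definition, no named fact.

WHAT (pure ultrametric algebra, `K` any normed field with `IsUltrametricDist`):
* `norm_tsum_eq_of_forall_ne_le` — the «isolated dominant term» principle: a summable series with ONE term of norm
  strictly above a common bound for all others has a sum of exactly that norm; hence (`not_lt_of_hasSum_zero`) a
  series summing to `0` has no isolated dominant term;
* `norm_sq_eq_of_hasSum_zero_oneSlope` — coefficients `‖cₙ‖ ≤ 1`, `c₀ = 0`, `‖c₁‖ = ϱ⁴`, `‖c₉‖ = 1`, `‖cₙ‖ ≤ ϱ⁴`
  for `9 ∤ n`: every root `t` with `0 < ‖t‖ < 1` of `Σ cₙ tⁿ` has `‖t‖² = ϱ` (the single slope of the segment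
  `(1, 4v(ϖ)) — (9, 0)`; this is the shape of `[3]` under Kobayashi's congruence `[3] ≡ h(t⁹) (mod 3)`);
* `norm_eq_or_norm_cube_eq_of_hasSum_zero_twoSlopes` — with instead `‖c₃‖ = ϱ²`, `c₆ = 0`, `‖cₙ‖ ≤ ϱ⁴` for
  `3 ∤ n`: `‖t‖ = ϱ` or `‖t‖³ = ϱ` (two slopes, vertices `(1, 4v(ϖ))`, `(3, 2v(ϖ))`, `(9, 0)` — the canonical-subgroup
  shape);
* `coeff_formalMul_eq_zero_of_even` — `[n]_W` is ODD when `a₁ = a₃ = 0`, over EVERY commutative ring (the tree's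
  `rescale_neg_one_formalMul` needs additive torsion-freeness; we pass through the universal short model over
  `ℤ[A₂, A₄, A₆]`).

References: J. Lubin, *One-parameter formal Lie groups over p-adic integer rings*, Ann. of Math. 80 (1964) §1
(Newton polygon of `[p]`); J. H. Silverman, *AEC* IV.2.3, IV.6.1. [cite: SilvermanAEC2009, IV.6.1]
-/

-- D-0017: single-problem summit, so `Summit.BirchSwinnertonDyer.BirchSwinnertonDyer.…` repeats a namespace BY DESIGN.
set_option linter.dupNamespace false

noncomputable section

open PowerSeries

namespace Summit.BirchSwinnertonDyer.BirchSwinnertonDyer.Theorems.SolventPairLowerBound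

/-! ## §1. Ultrametric series: an isolated dominant term is the norm of the sum -/

section Ultrametric

variable {K : Type*} [NormedField K] [IsUltrametricDist K]

/-- **Isolated dominant term.** In an ultrametric normed field, if a summable series has one term of norm
STRICTLY larger than a common bound for all the others, the sum has the norm of that term. [folklore] -/
theorem norm_tsum_eq_of_forall_ne_le {f : ℕ → K} (hf : Summable f) (n₀ : ℕ) {B : ℝ} (hB0 : 0 ≤ B)
    (hB : ∀ n, n ≠ n₀ → ‖f n‖ ≤ B) (hlt : B < ‖f n₀‖) : ‖∑' n, f n‖ = ‖f n₀‖ := by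
  classical
  rw [hf.tsum_eq_add_tsum_ite n₀]
  have hrest : ‖∑' n, (if n = n₀ then 0 else f n)‖ ≤ B :=
    IsUltrametricDist.norm_tsum_le_of_forall_le_of_nonneg hB0 fun n ↦ by
      split_ifs with h
      · simpa using hB0
      · exact hB n h
  have hne : ‖f n₀‖ ≠ ‖∑' n, (if n = n₀ then 0 else f n)‖ := by
    intro h; rw [h] at hlt; exact (not_lt.mpr hrest) hlt
  rw [IsUltrametricDist.norm_add_eq_max_of_norm_ne_norm hne, max_eq_left (hrest.trans hlt.le)]

/-- Contrapositive form used below: a series summing to `0` has no isolated dominant term. [folklore] -/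
theorem not_lt_of_hasSum_zero {f : ℕ → K} (hf : HasSum f 0) (n₀ : ℕ) {B : ℝ} (hB0 : 0 ≤ B)
    (hB : ∀ n, n ≠ n₀ → ‖f n‖ ≤ B) : ¬ B < ‖f n₀‖ := by
  intro hlt
  have h := norm_tsum_eq_of_forall_ne_le hf.summable n₀ hB0 hB hlt
  rw [hf.tsum_eq, norm_zero] at h
  exact (hB0.trans_lt hlt).ne' h.symm

/-! ## §2. One slope: the Newton polygon `(1, v(3)) — (9, 0)` (case B) -/

/-- **Case B root norms (pure form).** Coefficients `cₙ` with `‖cₙ‖ ≤ 1`, `c₀ = 0`, `‖c₁‖ = ϱ⁴`, `‖c₉‖ = 1` and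
`‖cₙ‖ ≤ ϱ⁴` whenever `9 ∤ n` (`0 < ϱ < 1`): every `t` with `0 < ‖t‖ < 1` and `Σ cₙ tⁿ = 0` has `‖t‖² = ϱ`
(i.e. `‖t‖⁸ = ‖c₁‖`: the unique slope of the segment from `(1, 4)` to `(9, 0)`). [Lubin 1964 §1] [folklore] -/
theorem norm_sq_eq_of_hasSum_zero_oneSlope {c : ℕ → K} {ϱ : ℝ} (hϱ0 : 0 < ϱ)
    (hint : ∀ n, ‖c n‖ ≤ 1) (h0 : c 0 = 0) (h1 : ‖c 1‖ = ϱ ^ 4) (h9 : ‖c 9‖ = 1)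
    (hdiv : ∀ n, ¬ 9 ∣ n → ‖c n‖ ≤ ϱ ^ 4) {t : K} (ht0 : t ≠ 0) (ht1 : ‖t‖ < 1)
    (hsum : HasSum (fun n ↦ c n * t ^ n) 0) : ‖t‖ ^ 2 = ϱ := by
  set s := ‖t‖ with hs
  have hs0 : 0 < s := norm_pos_iff.mpr ht0
  have hϱ4 : 0 < ϱ ^ 4 := pow_pos hϱ0 4
  have hterm : ∀ n, ‖c n * t ^ n‖ = ‖c n‖ * s ^ n := fun n ↦ by rw [norm_mul, norm_pow]
  -- generic bounds on the terms
  have hA : ∀ n, ¬ 9 ∣ n → ‖c n * t ^ n‖ ≤ ϱ ^ 4 * s ^ n := fun n hn ↦ by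
    rw [hterm]; exact mul_le_mul_of_nonneg_right (hdiv n hn) (pow_nonneg hs0.le n)
  have hB : ∀ n, ‖c n * t ^ n‖ ≤ s ^ n := fun n ↦ by
    rw [hterm]; exact (mul_le_mul_of_nonneg_right (hint n) (pow_nonneg hs0.le n)).trans (by rw [one_mul])
  have hpow : ∀ {m n : ℕ}, m ≤ n → s ^ n ≤ s ^ m := fun h ↦ pow_le_pow_of_le_one hs0.le ht1.le h
  rcases lt_trichotomy (s ^ 8) (ϱ ^ 4) with hlt | heq | hgt
  · -- `s⁸ < ϱ⁴`: the term `n = 1` is isolated dominant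
    exfalso
    refine not_lt_of_hasSum_zero hsum 1 (B := max (ϱ ^ 4 * s ^ 2) (s ^ 9)) (by positivity) ?_ ?_
    · intro n hn
      rcases Nat.lt_or_ge n 2 with h2 | h2
      · interval_cases n
        · rw [h0, zero_mul, norm_zero]; positivity
        · exact absurd rfl hn
      by_cases h9n : 9 ∣ n
      · obtain ⟨k, rfl⟩ := h9n
        have hk : 1 ≤ k := by omega
        exact (hB _).trans ((hpow (by omega)).trans (le_max_right _ _))
      · exact (hA n h9n).trans ((mul_le_mul_of_nonneg_left (hpow h2) hϱ4.le).trans (le_max_left _ _))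
    · rw [hterm, h1, pow_one]
      refine max_lt ?_ ?_
      · have : s ^ 2 < s := by
          calc s ^ 2 = s * s := sq s
            _ < s * 1 := mul_lt_mul_of_pos_left ht1 hs0
            _ = s := mul_one s
        exact mul_lt_mul_of_pos_left this hϱ4
      · calc s ^ 9 = s ^ 8 * s := pow_succ s 8
          _ < ϱ ^ 4 * s := mul_lt_mul_of_pos_right hlt hs0
  · -- `s⁸ = ϱ⁴`
    have h : (s ^ 2) ^ 4 = ϱ ^ 4 := by rw [← pow_mul]; exact heq
    exact (pow_left_inj₀ (pow_nonneg hs0.le 2) hϱ0.le (by norm_num)).mp h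
  · -- `s⁸ > ϱ⁴`: the term `n = 9` is isolated dominant
    exfalso
    refine not_lt_of_hasSum_zero hsum 9 (B := max (ϱ ^ 4 * s) (s ^ 10)) (by positivity) ?_ ?_
    · intro n hn
      by_cases h9n : 9 ∣ n
      · obtain ⟨k, rfl⟩ := h9n
        rcases Nat.lt_or_ge k 1 with hk | hk
        · interval_cases k; rw [Nat.mul_zero, h0, zero_mul, norm_zero]; positivity
        · have hk2 : 2 ≤ k := by
            rcases Nat.lt_or_ge k 2 with hk2 | hk2
            · interval_cases k; exact absurd rfl hn
            · exact hk2
          exact (hB _).trans ((hpow (by omega)).trans (le_max_right _ _))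
      · have hn1 : 1 ≤ n := by
          rcases Nat.lt_or_ge n 1 with h | h
          · interval_cases n; exact absurd (dvd_zero 9) h9n
          · exact h
        exact (hA n h9n).trans ((mul_le_mul_of_nonneg_left (hpow hn1) hϱ4.le).trans
          (by rw [pow_one]; exact le_max_left _ _))
    · rw [hterm, h9, one_mul]
      refine max_lt ?_ ?_
      · calc ϱ ^ 4 * s < s ^ 8 * s := mul_lt_mul_of_pos_right hgt hs0
          _ = s ^ 9 := (pow_succ s 8).symm
      · calc s ^ 10 = s ^ 9 * s := pow_succ s 9
          _ < s ^ 9 * 1 := mul_lt_mul_of_pos_left ht1 (pow_pos hs0 9)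
          _ = s ^ 9 := mul_one _

/-! ## §3. Two slopes: the Newton polygon `(1, v(3)) — (3, v(3)/2) — (9, 0)` (case A) -/

/-- **Case A root norms (pure form).** Coefficients `cₙ` with `‖cₙ‖ ≤ 1`, `c₀ = c₆ = 0`, `‖c₁‖ = ϱ⁴`,
`‖c₃‖ = ϱ²`, `‖c₉‖ = 1` and `‖cₙ‖ ≤ ϱ⁴` whenever `3 ∤ n` (`0 < ϱ < 1`): every `t` with `0 < ‖t‖ < 1` and
`Σ cₙ tⁿ = 0` has `‖t‖ = ϱ` or `‖t‖³ = ϱ` (the two slopes `v(3)/4`, `v(3)/12`). [Lubin 1964 §1] [folklore] -/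
theorem norm_eq_or_norm_cube_eq_of_hasSum_zero_twoSlopes {c : ℕ → K} {ϱ : ℝ} (hϱ0 : 0 < ϱ) (hϱ1 : ϱ < 1)
    (hint : ∀ n, ‖c n‖ ≤ 1) (h0 : c 0 = 0) (h1 : ‖c 1‖ = ϱ ^ 4) (h3 : ‖c 3‖ = ϱ ^ 2) (h6 : c 6 = 0)
    (h9 : ‖c 9‖ = 1) (hdiv : ∀ n, ¬ 3 ∣ n → ‖c n‖ ≤ ϱ ^ 4) {t : K} (ht0 : t ≠ 0) (ht1 : ‖t‖ < 1)
    (hsum : HasSum (fun n ↦ c n * t ^ n) 0) : ‖t‖ = ϱ ∨ ‖t‖ ^ 3 = ϱ := by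
  set s := ‖t‖ with hs
  have hs0 : 0 < s := norm_pos_iff.mpr ht0
  have hϱ4 : 0 < ϱ ^ 4 := pow_pos hϱ0 4
  have hϱ2 : 0 < ϱ ^ 2 := pow_pos hϱ0 2
  have hterm : ∀ n, ‖c n * t ^ n‖ = ‖c n‖ * s ^ n := fun n ↦ by rw [norm_mul, norm_pow]
  have hA : ∀ n, ¬ 3 ∣ n → ‖c n * t ^ n‖ ≤ ϱ ^ 4 * s ^ n := fun n hn ↦ by
    rw [hterm]; exact mul_le_mul_of_nonneg_right (hdiv n hn) (pow_nonneg hs0.le n)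
  have hB : ∀ n, ‖c n * t ^ n‖ ≤ s ^ n := fun n ↦ by
    rw [hterm]; exact (mul_le_mul_of_nonneg_right (hint n) (pow_nonneg hs0.le n)).trans (by rw [one_mul])
  have hpow : ∀ {m n : ℕ}, m ≤ n → s ^ n ≤ s ^ m := fun h ↦ pow_le_pow_of_le_one hs0.le ht1.le h
  have hspow : ∀ {m n : ℕ}, m < n → s ^ n < s ^ m := fun h ↦ pow_lt_pow_right_of_lt_one₀ hs0 ht1 h
  have hT1 : ‖c 1 * t ^ 1‖ = ϱ ^ 4 * s := by rw [hterm, h1, pow_one]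
  have hT3 : ‖c 3 * t ^ 3‖ = ϱ ^ 2 * s ^ 3 := by rw [hterm, h3]
  have hT9 : ‖c 9 * t ^ 9‖ = s ^ 9 := by rw [hterm, h9, one_mul]
  -- every term other than `n ∈ {1, 3, 9}` is bounded by `max (ϱ⁴ s²) s¹²`, and `n = 1, 3, 9` by the displayed values
  have hrest : ∀ n, n ≠ 1 → n ≠ 3 → n ≠ 9 → ‖c n * t ^ n‖ ≤ max (ϱ ^ 4 * s ^ 2) (s ^ 12) := by
    intro n hn1 hn3 hn9
    by_cases h3n : 3 ∣ n
    · obtain ⟨k, rfl⟩ := h3n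
      rcases Nat.lt_or_ge k 4 with hk | hk
      · interval_cases k
        · rw [Nat.mul_zero, h0, zero_mul, norm_zero]; positivity
        · exact absurd rfl hn3
        · rw [show 3 * 2 = 6 from rfl, h6, zero_mul, norm_zero]; positivity
        · exact absurd rfl hn9
      · exact (hB _).trans ((hpow (by omega)).trans (le_max_right _ _))
    · have hn2 : 2 ≤ n := by
        rcases Nat.lt_or_ge n 2 with h | h
        · interval_cases n
          · exact absurd (dvd_zero 3) h3n
          · exact absurd rfl hn1
        · exact h
      exact (hA n h3n).trans ((mul_le_mul_of_nonneg_left (hpow hn2) hϱ4.le).trans (le_max_left _ _))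
  have hs2 : ϱ ^ 4 * s ^ 2 < ϱ ^ 4 * s := mul_lt_mul_of_pos_left (by simpa using hspow one_lt_two) hϱ4
  have hs12 : s ^ 12 < s ^ 9 := hspow (by norm_num)
  by_cases he1 : s = ϱ
  · exact Or.inl he1
  by_cases he3 : s ^ 3 = ϱ
  · exact Or.inr he3
  exfalso
  rcases lt_or_gt_of_ne he1 with hlt1 | hgt1
  · -- `s < ϱ`: the term `n = 1` is isolated dominant
    have h31 : ϱ ^ 2 * s ^ 3 < ϱ ^ 4 * s := by
      have : s ^ 2 < ϱ ^ 2 := pow_lt_pow_left₀ hlt1 hs0.le two_ne_zero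
      nlinarith [mul_pos hϱ2 hs0]
    have h91 : s ^ 9 < ϱ ^ 4 * s := by
      have h8 : s ^ 8 < ϱ ^ 8 := pow_lt_pow_left₀ hlt1 hs0.le (by norm_num)
      have h88 : ϱ ^ 8 ≤ ϱ ^ 4 := pow_le_pow_of_le_one hϱ0.le hϱ1.le (by norm_num)
      nlinarith
    refine not_lt_of_hasSum_zero hsum 1
      (B := max (max (ϱ ^ 2 * s ^ 3) (s ^ 9)) (max (ϱ ^ 4 * s ^ 2) (s ^ 12))) (by positivity) ?_ ?_
    · intro n hn
      by_cases hn3 : n = 3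
      · subst hn3; rw [hT3]; exact le_max_of_le_left (le_max_left _ _)
      by_cases hn9 : n = 9
      · subst hn9; rw [hT9]; exact le_max_of_le_left (le_max_right _ _)
      exact (hrest n hn hn3 hn9).trans (le_max_right _ _)
    · rw [hT1]
      exact max_lt (max_lt h31 h91) (max_lt hs2 (hs12.trans h91))
  · rcases lt_or_gt_of_ne he3 with hlt3 | hgt3
    · -- `ϱ < s`, `s³ < ϱ`: the term `n = 3` is isolated dominant
      have h13 : ϱ ^ 4 * s < ϱ ^ 2 * s ^ 3 := by
        have : ϱ ^ 2 < s ^ 2 := pow_lt_pow_left₀ hgt1 hϱ0.le two_ne_zero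
        nlinarith [mul_pos hϱ2 hs0]
      have h93 : s ^ 9 < ϱ ^ 2 * s ^ 3 := by
        have : s ^ 6 < ϱ ^ 2 := by
          calc s ^ 6 = (s ^ 3) ^ 2 := by ring
            _ < ϱ ^ 2 := pow_lt_pow_left₀ hlt3 (pow_nonneg hs0.le 3) two_ne_zero
        nlinarith [pow_pos hs0 3]
      refine not_lt_of_hasSum_zero hsum 3
        (B := max (max (ϱ ^ 4 * s) (s ^ 9)) (max (ϱ ^ 4 * s ^ 2) (s ^ 12))) (by positivity) ?_ ?_
      · intro n hn
        by_cases hn1 : n = 1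
        · subst hn1; rw [hT1]; exact le_max_of_le_left (le_max_left _ _)
        by_cases hn9 : n = 9
        · subst hn9; rw [hT9]; exact le_max_of_le_left (le_max_right _ _)
        exact (hrest n hn1 hn hn9).trans (le_max_right _ _)
      · rw [hT3]
        exact max_lt (max_lt h13 h93) (max_lt (hs2.trans h13) (hs12.trans h93))
    · -- `ϱ < s³`: the term `n = 9` is isolated dominant
      have h39 : ϱ ^ 2 * s ^ 3 < s ^ 9 := by
        have : ϱ ^ 2 < s ^ 6 := by
          calc ϱ ^ 2 < (s ^ 3) ^ 2 := pow_lt_pow_left₀ hgt3 hϱ0.le two_ne_zero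
            _ = s ^ 6 := by ring
        nlinarith [pow_pos hs0 3]
      have h19 : ϱ ^ 4 * s < s ^ 9 := by
        have hs3 : s ^ 3 ≤ s ^ 2 := hpow (by norm_num)
        have : ϱ < s ^ 2 := hgt3.trans_le hs3
        have h4 : ϱ ^ 4 < (s ^ 2) ^ 4 := pow_lt_pow_left₀ this hϱ0.le (by norm_num)
        nlinarith
      refine not_lt_of_hasSum_zero hsum 9
        (B := max (max (ϱ ^ 4 * s) (ϱ ^ 2 * s ^ 3)) (max (ϱ ^ 4 * s ^ 2) (s ^ 12))) (by positivity) ?_ ?_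
      · intro n hn
        by_cases hn1 : n = 1
        · subst hn1; rw [hT1]; exact le_max_of_le_left (le_max_left _ _)
        by_cases hn3 : n = 3
        · subst hn3; rw [hT3]; exact le_max_of_le_left (le_max_right _ _)
        exact (hrest n hn1 hn3 hn).trans (le_max_right _ _)
      · rw [hT9]
        exact max_lt (max_lt h19 h39) (max_lt (hs2.trans h19) hs12)

end Ultrametric

/-! ## §4. Coefficient facts over an arbitrary ring: even coefficients of `[n]` vanish when `a₁ = a₃ = 0` -/

section Parity

open WeierstrassCurve

/-- **`[n]` is odd on `a₁ = a₃ = 0`, over EVERY commutative ring**: its even coefficients vanish. (The tree's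
`rescale_neg_one_formalMul` needs an additively torsion-free ring; we apply it to the universal short model
`y² = x³ + A₂x² + A₄x + A₆` over `ℤ[A₂, A₄, A₆]` and specialise with `map_formalMul`.) [Silverman AEC IV.2.3;
Blakestad–Grant 2023 §2] [cite: SilvermanAEC2009, IV.2.3] -/
theorem coeff_formalMul_eq_zero_of_even {R : Type*} [CommRing R] (W : WeierstrassCurve R) (ha₁ : W.a₁ = 0)
    (ha₃ : W.a₃ = 0) (n : ℕ) {k : ℕ} (hk : Even k) : PowerSeries.coeff k (W.formalMul n) = 0 := by
  classical
  -- the universal short model (a local literal, no new notion)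
  let U : WeierstrassCurve (MvPolynomial (Fin 3) ℤ) := ⟨0, MvPolynomial.X 0, 0, MvPolynomial.X 1, MvPolynomial.X 2⟩
  let φ : MvPolynomial (Fin 3) ℤ →+* R := MvPolynomial.eval₂Hom (Int.castRingHom R) ![W.a₂, W.a₄, W.a₆]
  have hmap : U.map φ = W := by
    ext <;> simp [U, φ, WeierstrassCurve.map, ha₁, ha₃]
  haveI : U.IsCharNeTwoNF := ⟨rfl, rfl⟩
  have huniv : PowerSeries.coeff k (U.formalMul n) = 0 :=
    Literature.NumberTheory.EllipticCurves.coeff_eq_zero_of_rescale_neg_one_eq_neg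
      (U.rescale_neg_one_formalMul n) hk
  have h := congrArg (PowerSeries.coeff k) (U.map_formalMul φ n)
  rw [PowerSeries.coeff_map, huniv, map_zero, hmap] at h
  exact h.symm

end Parity

end Summit.BirchSwinnertonDyer.BirchSwinnertonDyer.Theorems.SolventPairLowerBound

end
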